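import Mathlib
import HarnessLib
import Summits.CriticalPhenomena.PercolationContinuityZ3.Theses.PercBudgetLadder
import Literature.Probability.Percolation.MinOpenCut
import Literature.Probability.Percolation.SiteConnectionTools

/-!
# `stub_markov` of line `Sketch` (crux `BudgetTightness`, stmt-CriticalPhenomena-5248):
# a bounded expected critical annulus min-cut along a subsequence gives `BudgetTightness`

Registered stub `stub_markov` of the lead's skeleton `Cruxes/BudgetTightness/Lines/Sketch.lean`
(first lemma (a) of card `bk-first-moment-reduction`, proved by planner-cruxidea-stmt-CriticalPhenomena-5248-2-0
as `FirstMomentMarkov-ideator2.lean`; here restated DEF-FREE over tree declarations and landed).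

Statement: if for some aspect `l ≥ 2` and constant `C` there are infinitely many `n` with
`E_{p_c}[MinCut(n, l n)] ≤ C`, where `MinCut(n, l n) = minOpenCutIn B(l n) B(n) ∂ⁱⁿB(l n)` is the
min-cut budget of the annulus (`MinOpenCut.lean`; `minOpenCutIn_le_iff` is verbatim the route's budget
event), then `BudgetTightness` holds with budget `k = ⌈2C⌉`, the same `l`, and `c = 1/2`: Markov's
inequality `(k+1) P(MinCut ≥ k+1) ≤ E MinCut ≤ C ≤ (k+1)/2`.

Ingredients: the all-pairs cutset (`MinCut(n, l n) ≤ #pairs(B(l n))`, so the budget is finite and the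
integrand bounded), measurability of the level sets (`measurableSet_setOf_minOpenCutIn_le`), and
Mathlib's `mul_meas_ge_le_integral_of_nonneg`.
-/

noncomputable section

namespace Summit.CriticalPhenomena.PercolationContinuityZ3.Theorems.BudgetTightness

open MeasureTheory
open Literature.Probability.Percolation Literature.Probability.LatticeModels
open Summit.CriticalPhenomena.PercolationContinuityZ3.Theses.PercBudgetLadder


/-- Closing every pair of vertices of the outer box is an open cutset (for `1 ≤ n`, `2 ≤ l`). -/
theorem isOpenCutsetIn_allPairs {n l : ℕ} (hn : 1 ≤ n) (hl : 2 ≤ l) (ω : BondConfig (Site 3)) :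
    IsOpenCutsetIn (↑(box 3 (l * n)) : Set (Site 3)) ↑(box 3 n)
      ↑(innerBoundary (zdGraph 3) (box 3 (l * n))) ω ↑((box 3 (l * n)).sym2) := by
  intro x hx y hy hconn
  obtain ⟨hxS, hyS, hreach⟩ := hconn
  obtain ⟨w⟩ := hreach
  cases w with
  | nil =>
    -- a vertex of `box n` is not on the inner vertex boundary of `box (l n)` (`n ≥ 1`, `l ≥ 2`)
    have hx' := Finset.mem_coe.1 hx
    have hy' := Finset.mem_coe.1 hy
    obtain ⟨i, hi⟩ := exists_eq_of_mem_innerBoundary_box hy'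
    rw [mem_box] at hx'
    have hxi := hx' i
    have hln : (n : ℤ) + 1 ≤ ((l * n : ℕ) : ℤ) := by push_cast; nlinarith
    exact absurd hi (by omega)
  | cons hadj w' =>
    rename_i v
    have h1 := SimpleGraph.induce_adj.1 hadj
    rw [openGraph_adj] at h1
    obtain ⟨⟨hmem, hnot⟩, -⟩ := h1
    apply hnot
    rw [Finset.mem_coe, Finset.mk_mem_sym2_iff]
    exact ⟨Finset.mem_coe.1 hxS, Finset.mem_coe.1 v.2⟩

/-- The annulus min-cut is bounded by the number of pairs in the outer box. -/
theorem annulusMinCut_le_card {n l : ℕ} (hn : 1 ≤ n) (hl : 2 ≤ l) (ω : BondConfig (Site 3)) :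
    (minOpenCutIn (↑(box 3 (l * n)) : Set (Site 3)) (↑(box 3 n) : Set (Site 3))
      (↑(innerBoundary (zdGraph 3) (box 3 (l * n))) : Set (Site 3))) ω ≤ ((box 3 (l * n)).sym2).card :=
  minOpenCutIn_le_card (isOpenCutsetIn_allPairs hn hl ω)

/-- Level sets of the annulus min-cut are measurable. -/
theorem measurableSet_annulusMinCut_le (n l k : ℕ) :
    MeasurableSet {ω | (minOpenCutIn (↑(box 3 (l * n)) : Set (Site 3)) (↑(box 3 n) : Set (Site 3))
      (↑(innerBoundary (zdGraph 3) (box 3 (l * n))) : Set (Site 3))) ω ≤ k} :=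
  measurableSet_setOf_minOpenCutIn_le (Finset.finite_toSet _) _ _ k

/-- The annulus min-cut is a measurable `ℕ∞`-valued map. -/
theorem measurable_annulusMinCut (n l : ℕ) : Measurable ((minOpenCutIn (↑(box 3 (l * n)) : Set (Site 3)) (↑(box 3 n) : Set (Site 3))
      (↑(innerBoundary (zdGraph 3) (box 3 (l * n))) : Set (Site 3)))) := by
  rw [ENat.measurable_iff]
  intro k
  rcases Nat.eq_zero_or_pos k with rfl | hk
  · have : (minOpenCutIn (↑(box 3 (l * n)) : Set (Site 3)) (↑(box 3 n) : Set (Site 3))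
      (↑(innerBoundary (zdGraph 3) (box 3 (l * n))) : Set (Site 3))) ⁻¹' {((0 : ℕ) : ℕ∞)} = {ω | (minOpenCutIn (↑(box 3 (l * n)) : Set (Site 3)) (↑(box 3 n) : Set (Site 3))
      (↑(innerBoundary (zdGraph 3) (box 3 (l * n))) : Set (Site 3))) ω ≤ (0 : ℕ)} := by
      ext ω
      simp only [Set.mem_preimage, Set.mem_singleton_iff, Set.mem_setOf_eq, Nat.cast_zero,
        nonpos_iff_eq_zero]
    rw [this]; exact measurableSet_annulusMinCut_le n l 0
  · have : (minOpenCutIn (↑(box 3 (l * n)) : Set (Site 3)) (↑(box 3 n) : Set (Site 3))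
      (↑(innerBoundary (zdGraph 3) (box 3 (l * n))) : Set (Site 3))) ⁻¹' {(k : ℕ∞)} =
        {ω | (minOpenCutIn (↑(box 3 (l * n)) : Set (Site 3)) (↑(box 3 n) : Set (Site 3))
      (↑(innerBoundary (zdGraph 3) (box 3 (l * n))) : Set (Site 3))) ω ≤ k} \ {ω | (minOpenCutIn (↑(box 3 (l * n)) : Set (Site 3)) (↑(box 3 n) : Set (Site 3))
      (↑(innerBoundary (zdGraph 3) (box 3 (l * n))) : Set (Site 3))) ω ≤ (k - 1 : ℕ)} := by
      ext ω
      simp only [Set.mem_preimage, Set.mem_singleton_iff, Set.mem_sdiff, Set.mem_setOf_eq]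
      constructor
      · intro h
        rw [h]
        refine ⟨le_rfl, fun h' => ?_⟩
        have := Nat.cast_le.1 (show ((k : ℕ) : ℕ∞) ≤ (k - 1 : ℕ) from h')
        omega
      · rintro ⟨h1, h2⟩
        have hne : (minOpenCutIn (↑(box 3 (l * n)) : Set (Site 3)) (↑(box 3 n) : Set (Site 3))
      (↑(innerBoundary (zdGraph 3) (box 3 (l * n))) : Set (Site 3))) ω ≠ ⊤ := by
          intro htop; rw [htop] at h1; exact absurd h1 (by simp)
        obtain ⟨j, hj⟩ := ENat.ne_top_iff_exists.1 hne
        rw [← hj] at h1 h2 ⊢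
        have h1' := Nat.cast_le.1 (show ((j : ℕ) : ℕ∞) ≤ k from h1)
        have h2' : ¬ j ≤ k - 1 := fun h => h2 (by exact_mod_cast h)
        congr 1
        omega
    rw [this]
    exact (measurableSet_annulusMinCut_le n l k).diff (measurableSet_annulusMinCut_le n l (k - 1))

/-- **`stub_markov` (registered stub of line `Sketch`, crux stmt-CriticalPhenomena-5248): a bounded
expected critical annulus min-cut along a subsequence gives `BudgetTightness`** (Markov's inequality;
first lemma (a) of card `bk-first-moment-reduction`). The hypothesis is stated def-free, exactly as
registered in the skeleton; the conclusion is the crux `BudgetTightness` UNFOLDED (its definiens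
verbatim, see `budgetTightness_of_stub_markov` below for the named form). -/
theorem stub_markov :
    (∃ (l : ℕ) (C : ℝ), 2 ≤ l ∧ ∀ N : ℕ, ∃ n : ℕ, N ≤ n ∧
      ∫ ω, ((minOpenCutIn (↑(box 3 (l * n)) : Set (Site 3)) (↑(box 3 n) : Set (Site 3))
        (↑(innerBoundary (zdGraph 3) (box 3 (l * n))) : Set (Site 3)) ω).toNat : ℝ)
        ∂(bondPercolation (zdGraph 3) (criticalProbI 3)) ≤ C) →
      ∃ (k l : ℕ) (c : ℝ), 2 ≤ l ∧ 0 < c ∧ ∀ N : ℕ, ∃ n : ℕ, N ≤ n ∧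
        c ≤ (bondPercolation (zdGraph 3) (criticalProbI 3)).real
          {ω | ∃ S : Finset (Sym2 (Site 3)), S.card ≤ k ∧
            ¬ ∃ x ∈ box 3 n, ∃ y ∈ innerBoundary (zdGraph 3) (box 3 (l * n)),
              (ω \ ↑S) ∈ openConnIn (↑(box 3 (l * n)) : Set (Site 3)) x y} := by
  rintro ⟨l, C, hl, hio⟩
  -- the budget: any natural `k` with `2 C ≤ k`
  obtain ⟨k, hk⟩ : ∃ k : ℕ, 2 * C ≤ k := ⟨⌈2 * C⌉₊, Nat.le_ceil _⟩
  refine ⟨k, l, 1 / 2, hl, by norm_num, fun N => ?_⟩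
  obtain ⟨n, hn, hint⟩ := hio (max N 1)
  have hn1 : 1 ≤ n := le_trans (le_max_right _ _) hn
  refine ⟨n, le_trans (le_max_left _ _) hn, ?_⟩
  -- the route's event is `{MinCut ≤ k}`
  have hev : {ω : BondConfig (Site 3) | ∃ S : Finset (Sym2 (Site 3)), S.card ≤ k ∧
      ¬ ∃ x ∈ box 3 n, ∃ y ∈ innerBoundary (zdGraph 3) (box 3 (l * n)),
        (ω \ ↑S) ∈ openConnIn (↑(box 3 (l * n)) : Set (Site 3)) x y} =
      {ω | (minOpenCutIn (↑(box 3 (l * n)) : Set (Site 3)) (↑(box 3 n) : Set (Site 3))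
      (↑(innerBoundary (zdGraph 3) (box 3 (l * n))) : Set (Site 3))) ω ≤ k} := by
    ext ω
    simp only [Set.mem_setOf_eq, minOpenCutIn_le_iff, Finset.mem_coe]
  rw [hev]
  -- the real-valued min-cut
  set g : BondConfig (Site 3) → ℝ := fun ω => (((minOpenCutIn (↑(box 3 (l * n)) : Set (Site 3)) (↑(box 3 n) : Set (Site 3))
      (↑(innerBoundary (zdGraph 3) (box 3 (l * n))) : Set (Site 3))) ω).toNat : ℝ) with hg
  have hgm : Measurable g := by
    have h1 : Measurable fun ω => ((minOpenCutIn (↑(box 3 (l * n)) : Set (Site 3)) (↑(box 3 n) : Set (Site 3))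
      (↑(innerBoundary (zdGraph 3) (box 3 (l * n))) : Set (Site 3))) ω).toNat :=
      (measurable_of_countable ENat.toNat).comp (measurable_annulusMinCut n l)
    exact (measurable_of_countable (fun j : ℕ => (j : ℝ))).comp h1
  have hg0 : ∀ ω, 0 ≤ g ω := fun ω => by simp [hg]
  set K : ℕ := ((box 3 (l * n)).sym2).card with hK
  have hgK : ∀ ω, g ω ≤ K := by
    intro ω
    have hle := annulusMinCut_le_card hn1 hl ω
    have hne : (minOpenCutIn (↑(box 3 (l * n)) : Set (Site 3)) (↑(box 3 n) : Set (Site 3))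
      (↑(innerBoundary (zdGraph 3) (box 3 (l * n))) : Set (Site 3))) ω ≠ ⊤ := ne_top_of_le_ne_top (ENat.coe_ne_top K) hle
    obtain ⟨j, hj⟩ := ENat.ne_top_iff_exists.1 hne
    simp only [hg, ← hj, ENat.toNat_coe, Nat.cast_le]
    rw [← hj] at hle
    exact_mod_cast hle
  have hgi : Integrable g (bondPercolation (zdGraph 3) (criticalProbI 3)) :=
    Integrable.of_bound hgm.aestronglyMeasurable K
      (Filter.Eventually.of_forall fun ω => by
        rw [Real.norm_eq_abs, abs_of_nonneg (hg0 ω)]; exact hgK ω)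
  -- Markov at level `k + 1`
  have hmarkov := mul_meas_ge_le_integral_of_nonneg (μ := bondPercolation (zdGraph 3) (criticalProbI 3))
    (Filter.Eventually.of_forall hg0) hgi ((k : ℝ) + 1)
  -- `{MinCut ≤ k}ᶜ = {k + 1 ≤ g}`
  have hcompl : {ω | (minOpenCutIn (↑(box 3 (l * n)) : Set (Site 3)) (↑(box 3 n) : Set (Site 3))
      (↑(innerBoundary (zdGraph 3) (box 3 (l * n))) : Set (Site 3))) ω ≤ k}ᶜ = {ω | (k : ℝ) + 1 ≤ g ω} := by
    ext ω
    simp only [Set.mem_compl_iff, Set.mem_setOf_eq, not_le, hg]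
    have hne : (minOpenCutIn (↑(box 3 (l * n)) : Set (Site 3)) (↑(box 3 n) : Set (Site 3))
      (↑(innerBoundary (zdGraph 3) (box 3 (l * n))) : Set (Site 3))) ω ≠ ⊤ :=
      ne_top_of_le_ne_top (ENat.coe_ne_top K) (annulusMinCut_le_card hn1 hl ω)
    obtain ⟨j, hj⟩ := ENat.ne_top_iff_exists.1 hne
    rw [← hj, ENat.toNat_coe]
    constructor
    · intro h
      have : k < j := by exact_mod_cast h
      exact_mod_cast (show k + 1 ≤ j by omega)
    · intro h
      have : (k : ℝ) + 1 ≤ (j : ℝ) := h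
      have : k + 1 ≤ j := by exact_mod_cast this
      exact_mod_cast (show k < j by omega)
  have hmeas : MeasurableSet {ω | (minOpenCutIn (↑(box 3 (l * n)) : Set (Site 3)) (↑(box 3 n) : Set (Site 3))
      (↑(innerBoundary (zdGraph 3) (box 3 (l * n))) : Set (Site 3))) ω ≤ k} := measurableSet_annulusMinCut_le n l k
  have hprob : (bondPercolation (zdGraph 3) (criticalProbI 3)).real {ω | (minOpenCutIn (↑(box 3 (l * n)) : Set (Site 3)) (↑(box 3 n) : Set (Site 3))
      (↑(innerBoundary (zdGraph 3) (box 3 (l * n))) : Set (Site 3))) ω ≤ k} = 1 - (bondPercolation (zdGraph 3) (criticalProbI 3)).real {ω | (k : ℝ) + 1 ≤ g ω} := by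
    rw [← hcompl, measureReal_compl hmeas, probReal_univ]
    ring
  rw [hprob]
  -- `(k+1) · P(g ≥ k+1) ≤ ∫ g ≤ C ≤ (k+1)/2`
  have hkpos : (0 : ℝ) < (k : ℝ) + 1 := by positivity
  have hP : (bondPercolation (zdGraph 3) (criticalProbI 3)).real {ω | (k : ℝ) + 1 ≤ g ω} ≤ C / ((k : ℝ) + 1) := by
    rw [le_div_iff₀ hkpos, mul_comm]
    exact hmarkov.trans hint
  have hC : C / ((k : ℝ) + 1) ≤ 1 / 2 := by
    rcases le_or_gt C 0 with hC0 | hC0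
    · exact (div_nonpos_of_nonpos_of_nonneg hC0 hkpos.le).trans (by norm_num)
    · rw [div_le_iff₀ hkpos]; linarith
  linarith

/-- Named form: the hypothesis of `stub_markov` implies the route decl `BudgetTightness` (by `Iff.rfl`
on its definiens). -/
theorem budgetTightness_of_stub_markov
    (h : ∃ (l : ℕ) (C : ℝ), 2 ≤ l ∧ ∀ N : ℕ, ∃ n : ℕ, N ≤ n ∧
      ∫ ω, ((minOpenCutIn (↑(box 3 (l * n)) : Set (Site 3)) (↑(box 3 n) : Set (Site 3))
        (↑(innerBoundary (zdGraph 3) (box 3 (l * n))) : Set (Site 3)) ω).toNat : ℝ)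
        ∂(bondPercolation (zdGraph 3) (criticalProbI 3)) ≤ C) :
    BudgetTightness :=
  stub_markov h

end Summit.CriticalPhenomena.PercolationContinuityZ3.Theorems.BudgetTightness

end
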